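import Summits.AnomalousDissipation.AnomalousDissipation.Theorems.SolenoidalFractalHomogenisationRealisedQuasiStaticCellLawWeakNearAtCell
import Summits.AnomalousDissipation.AnomalousDissipation.Theorems.SolenoidalFractalHomogenisationRealisedQuasiStaticCellLawSectorRelabel
import HarnessLib

/-!
# K2R `RealisedQuasiStaticCellLaw`, line `floquet-bloch`: the registered stub `stub_lowSectorWeakNear` (W-near road)
# (`--supports stmt-AnomalousDissipation-20446`)

Summits-side file (everything proved; no definitions, no named facts). The registered stub of skeleton r17–r19, verbatim:
for every `δ > 0`, with `M₀ = 400/δ`, `ν₀ = 10⁻³`, `K = 10⁵(M+1)/δ`, every sector `±ℓ + nℤ³` (`n ≥ ⌈K/ν⌉`) having a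
representative `k ≠ 0` with `|k|² < 1 + (1−δ)c_W/ν²`, `‖k‖ ≤ (δ/10⁴)·nν` and `|k|² ≤ 3` (weakly coupled, near shells)
decays under the replayed cell word at the rate `8π²(1 + (1−δ)c_W/ν²)ν/n²` with prefactor `K/ν` — by
`weakNear_decay_at_cell` (the co-moving / isotropic-pair road) applied to the representative `k`.
-/

set_option linter.dupNamespace false

noncomputable section

namespace Summit.AnomalousDissipation.AnomalousDissipation.Theorems.SolenoidalFractalHomogenisation.RealisedQuasiStaticCellLaw

open Set MeasureTheory
open Literature.Analysis Literature.Analysis.FunctionSpaces Literature.Analysis.FunctionSpaces.Torus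
open Literature.Analysis.FluidPDE Literature.Analysis.FluidPDE.LatticeShear

/-- **Stub `stub_lowSectorWeakNear` of skeleton r17 (W-near road), registered signature.** -/
theorem stub_lowSectorWeakNear : ∀ δ > (0:ℝ), ∃ M₀ > (0:ℝ), ∀ M : ℝ, ∀ hM : 0 < M, M₀ ≤ M → ∃ ν₀ > (0:ℝ), ∃ K > (0:ℝ),
    ∀ ν, ∀ hν : ν ∈ Ioo 0 ν₀, ∀ n : ℕ, ⌈K / ν⌉₊ ≤ n → ∀ ℓ : Fin 3 → ℤ,
    (∃ k : Fin 3 → ℤ, ((∃ z : Fin 3 → ℤ, k = ℓ + (n:ℤ) • z) ∨ (∃ z : Fin 3 → ℤ, k = -ℓ + (n:ℤ) • z)) ∧ k ≠ 0 ∧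
      FunctionSpaces.Torus.freqNormSq k < 1 + (1 - δ) * ((1 - 4 * cubatureWord.ramp / 3) * c0) / ν ^ 2 ∧
      ‖FunctionSpaces.Torus.latticeVec k‖ ≤ δ / 10000 * ((n:ℝ) * ν) ∧ FunctionSpaces.Torus.freqNormSq k ≤ 3) →
    ∀ w₀ : UnitAddTorus (Fin 3) → EuclideanSpace ℝ (Fin 3),
      FunctionSpaces.Torus.MemSobolev 1 (FunctionSpaces.EuclideanSpace.complexify ∘ w₀) →
      FunctionSpaces.Torus.IsWeaklyDivFree w₀ → FunctionSpaces.Torus.HasZeroMean w₀ →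
      (∀ k : Fin 3 → ℤ, ¬ ((∃ z : Fin 3 → ℤ, k = ℓ + (n:ℤ) • z) ∨ (∃ z : Fin 3 → ℤ, k = -ℓ + (n:ℤ) • z)) →
        UnitAddTorus.mFourierCoeff (FunctionSpaces.EuclideanSpace.complexify ∘ w₀) k = 0) → ∀ T > (0:ℝ), ∀ w,
      Torus.IsWeakPassiveVectorOn 0 T (ν / (n:ℝ) ^ 2)
          (((cubatureWord.stretch M hM).stretch (1 / ν) (one_div_pos.mpr hν.1)).cell n) w₀ w →
      ∀ᵐ t ∂(volume.restrict (Ioo 0 T)),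
        ∫ x, ‖w t x‖ ^ 2 ≤ (K / ν) *
          Real.exp (-(8 * Real.pi ^ 2 * (1 + (1 - δ) * ((1 - 4 * cubatureWord.ramp / 3) * c0) / ν ^ 2) * ν
            / (n:ℝ) ^ 2) * t) * ∫ x, ‖w₀ x‖ ^ 2 := by
  intro δ hδ
  have hρ : cubatureWord.ramp = 1 / 2 := (cubature_phase_fields 0).2.2.2
  have hcW : 0 < (1 - 4 * cubatureWord.ramp / 3) * c0 := by have := c0_pos; rw [hρ]; positivity
  refine ⟨400 / δ, by positivity, fun M hM hM0 => ⟨1 / 1000, by norm_num,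
    100000 * (M + 1) / δ, by positivity, ?_⟩⟩
  intro ν hν n hn ℓ hsec w₀ hw₀ hdiv hmean hsupp T hT w hw
  obtain ⟨k, hkℓ, hk0, hkQ, hksmall, hk3⟩ := hsec
  -- `δ ≤ 1`: otherwise `1 ≤ |k|² < 1 + (1 − δ)c_W/ν² < 1`
  have hδ1 : δ ≤ 1 := by
    by_contra h
    have h1 : (1 - δ) * ((1 - 4 * cubatureWord.ramp / 3) * c0) / ν ^ 2 < 0 :=
      div_neg_of_neg_of_pos (mul_neg_of_neg_of_pos (by linarith) hcW) (by have := hν.1; positivity)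
    have h2 : 1 ≤ freqNormSq k := by
      rw [← norm_latticeVec_sq]; have := one_le_norm_latticeVec hk0; nlinarith
    linarith
  have hKn : 100000 * (M + 1) / δ ≤ (n : ℝ) * ν := (div_le_iff₀ hν.1).mp (Nat.ceil_le.mp hn)
  have hsupp' : ∀ k' : Fin 3 → ℤ, ¬ ((∃ z : Fin 3 → ℤ, k' = k + (n:ℤ) • z) ∨ (∃ z : Fin 3 → ℤ, k' = -k + (n:ℤ) • z)) →
      UnitAddTorus.mFourierCoeff (FunctionSpaces.EuclideanSpace.complexify ∘ w₀) k' = 0 :=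
    fun k' hk' => hsupp k' fun h => hk' ((sector_iff_of_rep hkℓ k').mp h)
  exact weakNear_decay_at_cell hδ hδ1 hM hM0 hν.1 hν.2.le hKn k hk0 hk3 hksmall hw₀ hdiv hmean hsupp' hT hw

end Summit.AnomalousDissipation.AnomalousDissipation.Theorems.SolenoidalFractalHomogenisation.RealisedQuasiStaticCellLaw

end
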